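import Summits.AtomisticToContinuum.Crystallization.Theorems.ShellTrichotomy.Negative.LinkPath
import Literature.Barriers.AtomisticToContinuum.IcosahedralClusters

/-!
# `ShellTrichotomy` (stmt-AtomisticToContinuum-18070), negative side II: the hard core is load-bearing

`shellTrichotomy_false_without_hardCore`: the crux with the single hypothesis `1 - 1/50 ≤ dist v w`
deleted (everything else verbatim, stated inline) is FALSE: the regular hexagonal antiprism inscribed in the unit sphere
(integer model `ApInt` at scale `100`; bonds `0.913–0.923 ≤ 51/50`, all other pairs `≥ 1.517 ≥ 63/50`,
radii `0.9992–1.0018`) is all-degree-4 (so neither capped nor torn) and every vertex carries three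
bonded triangles (face vector `(12,0,0,2)`, the two-hexagon map), so by the link-path obstruction it is
`1/5`-close to neither pattern.  Hence any proof of the crux must USE the hard core: quantitatively
(`not_trichotomyAt_core_091`, in the six-parameter form `TrichotomyAt`) the statement already fails with
the core lowered to `91/100`; numerically the two-hexagon map persists up to core/radius ratio `≈ 1/1.045`
(kit j022014, part C: `τ* ≈ 0.0425` at gap `63/50`), i.e. it is the hard core at `49/50` against radii
`≤ 51/50` that excludes it at the crux's constants.

Also: `TrichotomyAt rlo rhi dlo dhi gap η` (the crux with its six constants as parameters;
`shellTrichotomy_iff : ShellTrichotomy ↔ TrichotomyAt (1-1/50) (1+1/50) (1-1/50) (1+1/50) (63/50) (1/5)`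
by `Iff.rfl`) and `trichotomyAt_mono` (widening the radius window / lowering the core is harder).

Negative-side support (no route item is concluded positively).  Disprover seat
refuter-cdisprove-stmt-AtomisticToContinuum-18070-0, 2026-08-17.
-/

noncomputable section

namespace Summit.AtomisticToContinuum.Crystallization.Theorems.ShellTrichotomyNegative

open Literature.Geometry.DiscreteGeometry
open Summit.AtomisticToContinuum.Crystallization.Theorems.ShellCensusNegative

/-! ## (a) Load-bearing hypotheses

### The hard core `49/50 ≤ dist v w` is load-bearing: the inscribed hexagonal antiprism

Drop only the lower bound on pair distances. Then the REGULAR HEXAGONAL ANTIPRISM inscribed in the unit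
sphere (edge `0.9194`, all 24 edges bonds `≤ 51/50`, every other pair `≥ 1.517 ≥ 63/50`, all twelve
bond-degrees `= 4`, every vertex in THREE bonded triangles — face vector `(12, 0, 0, 2)`, the "two-hexagon
map") satisfies every remaining hypothesis and none of the four conclusions. Integer model at scale `100`. -/

/-- integer model (scale `100`) of the inscribed regular hexagonal antiprism: top hexagon at height
`39`, bottom hexagon (rotated by `30°`) at height `-39`, circumradius `≈ 100`. [folklore] -/
def ApInt : Finset (Fin 3 → ℤ) :=
  {![92, 0, 39], ![46, 80, 39], ![-46, 80, 39], ![-92, 0, 39], ![-46, -80, 39], ![46, -80, 39],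
   ![80, 46, -39], ![0, 92, -39], ![-80, 46, -39], ![-80, -46, -39], ![0, -92, -39], ![80, -46, -39]}

/-- twelve distinct integer vectors. [folklore] -/
theorem ApInt_card : ApInt.card = 12 := by decide
/-- radii in `[98, 102]` (squared). [folklore] -/
theorem ApInt_norm : ∀ v ∈ ApInt, (9604 : ℤ) ≤ sqNormInt v ∧ sqNormInt v ≤ 10404 := by decide
/-- every pair is a bond (`≤ 102²`) or far (`≥ 126²`). [folklore] -/
theorem ApInt_dist : ∀ v ∈ ApInt, ∀ w ∈ ApInt, v ≠ w →
    (sqNormInt (v - w) ≤ 10404 ∨ (15876 : ℤ) ≤ sqNormInt (v - w)) := by decide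
/-- all twelve bond-degrees are exactly four. [folklore] -/
theorem ApInt_degree : ∀ v ∈ ApInt, (ApInt.filter fun w => w ≠ v ∧ sqNormInt (v - w) ≤ 10404).card = 4 := by
  decide
/-- the shortest pair has squared length `8344` (bond `0.9134`). [folklore] -/
theorem ApInt_mindist : ∀ v ∈ ApInt, ∀ w ∈ ApInt, v ≠ w → (8344 : ℤ) ≤ sqNormInt (v - w) := by decide

/-- the fan vertex `t0 = (92, 0, 39)` and its link path top₁ – bot₀ – bot₅ – top₅ [folklore] -/
def apV : Fin 3 → ℤ := ![92, 0, 39]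
/-- the link path [folklore] -/
def apN : Fin 4 → (Fin 3 → ℤ) := ![![46, 80, 39], ![80, 46, -39], ![80, -46, -39], ![46, -80, 39]]
/-- the fan vertex is a witness point. [folklore] -/
theorem apV_mem : apV ∈ ApInt := by decide
/-- its link path lies in the witness. [folklore] -/
theorem apN_mem : ∀ i, apN i ∈ ApInt := by decide
/-- four distinct link points. [folklore] -/
theorem apN_inj : Function.Injective apN := by decide
/-- none of them is the fan vertex. [folklore] -/
theorem apN_ne : ∀ i, apN i ≠ apV := by decide
/-- spokes and link-path edges have squared length `≤ 93² = 8649`. [folklore] -/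
theorem apN_spoke : ∀ i, sqNormInt (apV - apN i) ≤ 8649 := by decide
/-- link-path edges `≤ 93/100`. [folklore] -/
theorem apN_path : sqNormInt (apN 0 - apN 1) ≤ 8649 ∧ sqNormInt (apN 1 - apN 2) ≤ 8649 ∧
    sqNormInt (apN 2 - apN 3) ≤ 8649 := by decide

/-- the witness map `v ↦ v / 100` [folklore] -/
def apmap (v : Fin 3 → ℤ) : (EuclideanSpace ℝ (Fin 3)) := ((100 : ℕ) : ℝ)⁻¹ • intVec v
/-- **the antiprism witness** [folklore] -/
def Ap : Finset (EuclideanSpace ℝ (Fin 3)) := ApInt.image apmap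

/-- the witness map is injective. [folklore] -/
theorem apmap_injective : Function.Injective apmap := by
  have hc : ((100 : ℕ) : ℝ)⁻¹ ≠ 0 := by positivity
  exact (smul_right_injective (EuclideanSpace ℝ (Fin 3)) hc).comp intVec_injective
/-- norms of witness points from the integer model. [folklore] -/
theorem norm_apmap (v : Fin 3 → ℤ) : ‖apmap v‖ = Real.sqrt (sqNormInt v : ℝ) / (100 : ℕ) := norm_div_intVec _ _
/-- distances of witness points from the integer model. [folklore] -/
theorem dist_apmap (v w : Fin 3 → ℤ) : dist (apmap v) (apmap w) = Real.sqrt (sqNormInt (v - w) : ℝ) / (100 : ℕ) :=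
  dist_div_intVec _ _ _

/-- bond test in integers: `dist ≤ 51/50 ↔ squared integer distance ≤ 102²`. [folklore] -/
theorem dist_apmap_le_iff (v w : Fin 3 → ℤ) : dist (apmap v) (apmap w) ≤ 1 + 1 / 50 ↔ sqNormInt (v - w) ≤ 10404 := by
  rw [dist_apmap, sqrt_div_le_iff (by norm_num) (Literature.Barriers.AtomisticToContinuum.sqNormInt_nonneg _) (by norm_num)]
  constructor
  · intro h
    have h' : (sqNormInt (v - w) : ℝ) ≤ ((10404 : ℤ) : ℝ) := by push_cast at h ⊢; nlinarith [h]
    exact_mod_cast h'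
  · intro h
    have h' : (sqNormInt (v - w) : ℝ) ≤ ((10404 : ℤ) : ℝ) := by exact_mod_cast h
    push_cast at h' ⊢; nlinarith [h']

/-- hypothesis 1 (cardinality) for the witness. [folklore] -/
theorem Ap_card : Ap.card = 12 := by
  rw [Ap, Finset.card_image_of_injective _ apmap_injective, ApInt_card]

/-- hypothesis 2 (radii) for the witness. [folklore] -/
theorem Ap_norm : ∀ x ∈ Ap, 1 - 1 / 50 ≤ ‖x‖ ∧ ‖x‖ ≤ 1 + 1 / 50 := by
  intro x hx
  obtain ⟨v, hv, rfl⟩ := Finset.mem_image.1 hx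
  obtain ⟨h1, h2⟩ := ApInt_norm v hv
  have h1' : ((9604 : ℤ) : ℝ) ≤ (sqNormInt v : ℝ) := by exact_mod_cast h1
  have h2' : (sqNormInt v : ℝ) ≤ ((10404 : ℤ) : ℝ) := by exact_mod_cast h2
  rw [norm_apmap]
  constructor
  · apply le_sqrt_div (by norm_num) (by norm_num); push_cast at h1' ⊢; nlinarith [h1']
  · apply sqrt_div_le (by norm_num) (by norm_num); push_cast at h2' ⊢; nlinarith [h2']

/-- hypothesis 3 without the hard core (bond or far) for the witness. [folklore] -/
theorem Ap_dist : ∀ x ∈ Ap, ∀ y ∈ Ap, x ≠ y → (dist x y ≤ 1 + 1 / 50 ∨ 63 / 50 ≤ dist x y) := by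
  intro x hx y hy hxy
  obtain ⟨v, hv, rfl⟩ := Finset.mem_image.1 hx
  obtain ⟨w, hw, rfl⟩ := Finset.mem_image.1 hy
  have hvw : v ≠ w := by rintro rfl; exact hxy rfl
  rcases ApInt_dist v hv w hw hvw with h | h
  · exact Or.inl ((dist_apmap_le_iff v w).2 h)
  · right
    have h' : ((15876 : ℤ) : ℝ) ≤ (sqNormInt (v - w) : ℝ) := by exact_mod_cast h
    rw [dist_apmap]
    apply le_sqrt_div (by norm_num) (by norm_num); push_cast at h' ⊢; nlinarith [h']

/-- bond-degrees of the witness, read off the integer model. [folklore] -/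
theorem Ap_degree : ∀ x ∈ Ap, (Ap.filter fun w => w ≠ x ∧ dist x w ≤ 1 + 1 / 50).card = 4 := by
  classical
  intro x hx
  obtain ⟨v, hv, rfl⟩ := Finset.mem_image.1 hx
  rw [← ApInt_degree v hv, Ap, Finset.filter_image, Finset.card_image_of_injective _ apmap_injective]
  congr 1
  apply Finset.filter_congr
  intro w _
  simp only [apmap_injective.ne_iff, dist_apmap_le_iff]

/-- the witness is `1/5`-close to neither pattern: three bonded triangles fanned at `apV / 100`
(`β = 93/100`, `93/100 + 2/5 < 1.414`). [folklore] -/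
theorem Ap_not_close {P : Finset (EuclideanSpace ℝ (Fin 3))} (hP : ∀ a ∈ P, (triCorners P 1.414 a).card ≤ 4) : ¬ ShellCloseTo (1 / 5) Ap P := by
  refine not_shellCloseTo_of_linkPath hP (β := 93 / 100) (by norm_num) (t0 := apmap apV)
    (Finset.mem_image_of_mem _ apV_mem) (fun i => apmap (apN i)) (fun i => Finset.mem_image_of_mem _ (apN_mem i))
    (fun i j h => apN_inj (apmap_injective h)) (fun i h => apN_ne i (apmap_injective h)) ?_ ?_ ?_ ?_
  · intro i
    have h := apN_spoke i
    have h' : (sqNormInt (apV - apN i) : ℝ) ≤ ((8649 : ℤ) : ℝ) := by exact_mod_cast h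
    rw [dist_apmap]; apply sqrt_div_le (by norm_num) (by norm_num); push_cast at h' ⊢; nlinarith [h']
  all_goals
    rw [dist_apmap]; apply sqrt_div_le (by norm_num) (by norm_num)
  · have h' : (sqNormInt (apN 0 - apN 1) : ℝ) ≤ ((8649 : ℤ) : ℝ) := by exact_mod_cast apN_path.1
    push_cast at h' ⊢; nlinarith [h']
  · have h' : (sqNormInt (apN 1 - apN 2) : ℝ) ≤ ((8649 : ℤ) : ℝ) := by exact_mod_cast apN_path.2.1
    push_cast at h' ⊢; nlinarith [h']
  · have h' : (sqNormInt (apN 2 - apN 3) : ℝ) ≤ ((8649 : ℤ) : ℝ) := by exact_mod_cast apN_path.2.2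
    push_cast at h' ⊢; nlinarith [h']

/-- **The hard-core hypothesis is load-bearing**: `ShellTrichotomy` with `49/50 ≤ dist v w` deleted is
FALSE — the inscribed regular hexagonal antiprism (bonds `0.92`) is all-degree-4, gapped, and three-fanned
at every vertex, hence `> 1/5` (bottleneck, after any linear isometry) from both patterns. Any proof of the
crux must use the hard core (it is what forbids short bonds and thereby the `(12,0,0,2)` two-hexagon map,
whose realisation with bonds `≥ 49/50` needs radii `≥ 1.0659`). [folklore] -/
theorem shellTrichotomy_false_without_hardCore :
    ¬ (∀ T : Finset (EuclideanSpace ℝ (Fin 3)), T.card = 12 → (∀ v ∈ T, 1 - 1 / 50 ≤ ‖v‖ ∧ ‖v‖ ≤ 1 + 1 / 50) →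
      (∀ v ∈ T, ∀ w ∈ T, v ≠ w → (dist v w ≤ 1 + 1 / 50 ∨ 63 / 50 ≤ dist v w)) →
      ShellCloseTo (1 / 5) T fccKissingPattern ∨ ShellCloseTo (1 / 5) T hcpKissingPattern ∨
      (∃ v ∈ T, 5 ≤ (T.filter fun w => w ≠ v ∧ dist v w ≤ 1 + 1 / 50).card) ∨
      (∃ v ∈ T, (T.filter fun w => w ≠ v ∧ dist v w ≤ 1 + 1 / 50).card ≤ 3)) := by
  intro h
  rcases h Ap Ap_card Ap_norm Ap_dist with hA | hA | ⟨v, hv, h5⟩ | ⟨v, hv, h3⟩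
  · exact Ap_not_close fcc_triCorners hA
  · exact Ap_not_close hcp_triCorners hA
  · rw [Ap_degree v hv] at h5; omega
  · rw [Ap_degree v hv] at h3; omega


/-! ## (b) The crux with its six constants as parameters; what is known where -/

/-- `TrichotomyAt rlo rhi dlo dhi gap η`: the crux with radius window `[rlo, rhi]`, bond window
`[dlo, dhi]`, gap threshold `gap` and closeness `η` (`ShellTrichotomy = TrichotomyAt (49/50) (51/50)
(49/50) (51/50) (63/50) (1/5)`, by `Iff.rfl`). [folklore] -/
def TrichotomyAt (rlo rhi dlo dhi gap η : ℝ) : Prop :=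
  ∀ T : Finset (EuclideanSpace ℝ (Fin 3)), T.card = 12 → (∀ v ∈ T, rlo ≤ ‖v‖ ∧ ‖v‖ ≤ rhi) →
    (∀ v ∈ T, ∀ w ∈ T, v ≠ w → dlo ≤ dist v w ∧ (dist v w ≤ dhi ∨ gap ≤ dist v w)) →
    ShellCloseTo η T fccKissingPattern ∨ ShellCloseTo η T hcpKissingPattern ∨
    (∃ v ∈ T, 5 ≤ (T.filter fun w => w ≠ v ∧ dist v w ≤ dhi).card) ∨
    (∃ v ∈ T, (T.filter fun w => w ≠ v ∧ dist v w ≤ dhi).card ≤ 3)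

/-- the crux is the six-parameter form at its constants (definitional). [folklore] -/
theorem shellTrichotomy_iff :
    Summit.AtomisticToContinuum.Crystallization.Theses.GappedShellCensus.ShellTrichotomy ↔
      TrichotomyAt (1 - 1 / 50) (1 + 1 / 50) (1 - 1 / 50) (1 + 1 / 50) (63 / 50) (1 / 5) := Iff.rfl

/-- monotonicity bookkeeping: widening the radius window or lowering the hard core can only make the
statement harder (the variants above are the two extreme widenings). [folklore] -/
theorem trichotomyAt_mono {rlo rlo' rhi rhi' dlo dlo' dhi gap η : ℝ} (hr : rlo' ≤ rlo) (hR : rhi ≤ rhi')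
    (hd : dlo' ≤ dlo) (h : TrichotomyAt rlo' rhi' dlo' dhi gap η) : TrichotomyAt rlo rhi dlo dhi gap η :=
  fun T hc hn hp => h T hc (fun v hv => ⟨hr.trans (hn v hv).1, (hn v hv).2.trans hR⟩)
    fun v hv w hw hvw => ⟨hd.trans (hp v hv w hw hvw).1, (hp v hv w hw hvw).2⟩

/-- **Hard core / radius ratio, quantitatively**: with bonds allowed down to `91/100` (radii, bond
ceiling, gap and `η` as in the crux) the trichotomy is false — same antiprism (its shortest bond is
`√8344/100 = 0.9134`; the regular one has all bonds `0.9194`). Equivalently (by scaling) radii up to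
`≈ 1.087` with unit bonds. The true threshold of the two-hexagon map lies between `0.9194` and `49/50`
(numerically `≈ 1/1.045`, kit j022014 part C). [folklore] -/
theorem not_trichotomyAt_core_091 : ¬ TrichotomyAt (1 - 1 / 50) (1 + 1 / 50) (91 / 100) (1 + 1 / 50) (63 / 50) (1 / 5) := by
  intro h
  have hpairs : ∀ x ∈ Ap, ∀ y ∈ Ap, x ≠ y → 91 / 100 ≤ dist x y ∧ (dist x y ≤ 1 + 1 / 50 ∨ 63 / 50 ≤ dist x y) := by
    intro x hx y hy hxy
    refine ⟨?_, Ap_dist x hx y hy hxy⟩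
    obtain ⟨v, hv, rfl⟩ := Finset.mem_image.1 hx
    obtain ⟨w, hw, rfl⟩ := Finset.mem_image.1 hy
    have hvw : v ≠ w := by rintro rfl; exact hxy rfl
    have hmin : (8344 : ℤ) ≤ sqNormInt (v - w) := ApInt_mindist v hv w hw hvw
    have h' : ((8344 : ℤ) : ℝ) ≤ (sqNormInt (v - w) : ℝ) := by exact_mod_cast hmin
    rw [dist_apmap]
    apply le_sqrt_div (by norm_num) (by norm_num); push_cast at h' ⊢; nlinarith [h']
  rcases h Ap Ap_card Ap_norm hpairs with hA | hA | ⟨v, hv, h5⟩ | ⟨v, hv, h3⟩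
  · exact Ap_not_close fcc_triCorners hA
  · exact Ap_not_close hcp_triCorners hA
  · rw [Ap_degree v hv] at h5; omega
  · rw [Ap_degree v hv] at h3; omega


end Summit.AtomisticToContinuum.Crystallization.Theorems.ShellTrichotomyNegative

end
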